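import Mathlib
import HarnessLib
import Literature.MathematicalPhysics.QuantumFieldTheory.Balaban1983to89.B13Contraction113
import Literature.MathematicalPhysics.QuantumFieldTheory.Balaban1983to89.B12Lineariz267
import Literature.MathematicalPhysics.QuantumFieldTheory.Balaban1983to89.B12LinearizAnalytic267
import Literature.MathematicalPhysics.QuantumFieldTheory.Balaban1983to89.B12SecondOrder267
import Literature.MathematicalPhysics.QuantumFieldTheory.Balaban1983to89.MatrixLog
import Literature.MathematicalPhysics.QuantumFieldTheory.Balaban1983to89.B12JacobianTrLog268

/-!
# B12 [Balaban1987RG1] (2.12)–(2.14) p. 268 — «the expression under the exponential above vanishes at g_k = 0»: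
# the displayed terms of the exponent of (2.12) ∕ the integrand of (2.13) as functions of the COUPLING `g = g_k`,
# schematic: each `(1/g²)·F(g·X)` with `F = O(‖·‖³)` analytic is `O(g)`, tends to `0`, equals `0` at `g = 0`, and is
# ANALYTIC in `g ∈ ℂ` THROUGH `g = 0` (removable singularity); the `Tr log` term and the curly bracket are analytic in
# `g` with value `0` at `g = 0`

CITATION. T. Bałaban, *Renormalization group approach to lattice gauge field theories. I. Generation of effective
actions in a small field approximation and a coupling constant renormalization in four dimensions*, Commun. Math.
Phys. 109 (1987) 249–301 [Balaban1987RG1] ("B12" of the cell), (2.12)–(2.14) p. 268 [PDF 20] and p. 267 [PDF 19]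
(renders `…1987-cmp109-rg-I-small-field-p020-x4.png`, `…-p019-x4.png`, read as images by the writing seat).  This
file sits on top of the tree leaves `B12Lineariz267` (the substitution `Φ(B) = B − hD̃(B)`, `‖hD̃(B)‖ ≤ 4C₂b‖B‖²`),
`B12LinearizAnalytic267` (analyticity of `D̃` and `Φ` on the ball), `B12SecondOrder267` (`D̃(0) = 0`, the remainder
`D̃₃ = D̃ − C̃⁽²⁾` is analytic and `O(‖B‖³)`, the scaling limit `g⁻²D̃(gB′) → C̃⁽²⁾(B′)`) and `B12JacobianTrLog268`
(`B ↦ Tr log DΦ(B)` analytic on the ball, `Tr log DΦ(0) = 0`), all used BY NAME; nothing of them is re-derived.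

THE PRINT (verbatim).  B12 p. 268 [PDF 20]: *«After these transformations we obtain the following expression for
the new action:»* — formula (2.12), whose fluctuation integral is (marked linear transcription of the display)
`log N_k″⁻¹ ∫ dμ_{C⁽ᵏ⁾}(B) χ_k exp[ Tr log(I − h((δ/δB)D̃)(g_kCB)) + log σ(g_kCB − hD̃(g_kCB)) + (1/g_k²)⟨H₁hD̃₃(g_kCB), J⟩
− (1/g_k²)G₃(g_kB) + (1/g_k²)⟨H₁g_kCB, Δ₁H₁hD̃(g_kCB)⟩ − (1/g_k²)⟨H₁hD̃(g_kCB), Δ₁H₁hD̃(g_kCB)⟩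
− (1/g_k²)V(H₁(g_kCB − hD̃(g_kCB))) + {E_k(U_k(exp i[g_kCB − hD̃(g_kCB)]V⁽ᵏ⁾)) − E_k(U_k(V⁽ᵏ⁾))} ]` — then:
*«Let us notice that the normalization constant N_k″ is equal to the integral above at U_{k+1} = 1. The
expression under the exponential is clearly a sum of two terms, one is connected with the expansion of the action
−(1/g_k²)A(U_k(V)) and the measure in (2.1), and we denote it by 𝐏⁽ᵏ⁾(g_k, U_{k+1}, B), another is the expression in
the curly bracket {…}. The integral in (2.12) defines the new term 𝐄⁽ᵏ⁺¹⁾ in the inductive definition of the action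
A_{k+1} by the formula»* (2.13) `𝐄⁽ᵏ⁺¹⁾(g_k, U_{k+1}) = log ∫ dμ_{C⁽ᵏ⁾}(B) χ_k exp[𝐏⁽ᵏ⁾(g_k, U_{k+1}, B) + {…}]`,
*«Let us remark that the expression under the exponential above vanishes at g_k = 0, and log N_k″ = 𝐄⁽ᵏ⁺¹⁾(g_k, 1).
(2.14)»*.  B12 p. 267 [PDF 19]: *«From this equation we obtain also that D̃(B) has an expansion beginning with
quadratic terms, and D̃⁽²⁾(B) = C̃⁽²⁾(B).»* … *«Next we make the scaling transformation B = g_kB′.»*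

READING (the cell's, not print's words).  After the scaling `B = g_kB′` every displayed term of the exponent is a
function of the coupling `g = g_k` of one of the shapes (a) `g ↦ (1/g²)·F(g·X)` with `F` analytic near `0` and
`F = O(‖·‖³)` — the terms `(1/g²)⟨H₁hD̃₃(gCB), J⟩` (`D̃₃ = O(‖B‖³)`, p. 267), `(1/g²)G₃(gB)`,
`(1/g²)⟨H₁gCB, Δ₁H₁hD̃(gCB)⟩` (bilinear in `(B, D̃)`, `D̃ = O(‖B‖²)`), `(1/g²)⟨H₁hD̃(gCB), Δ₁H₁hD̃(gCB)⟩` (quadratic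
in `D̃`), `(1/g²)V(H₁(gCB − hD̃(gCB)))` (`V` the remainder of order ≥ 3 of the expansion of the action) —, (b) the
Jacobian term `Tr log(I − h(δ/δB)D̃)(gCB)`, analytic in the field with value `0` at field `0`, (c) the curly bracket,
a difference vanishing when the field `gCB − hD̃(gCB)` is `0`; and (2.13) ∕ (2.14) use that the whole exponent is a
function of `g` vanishing at `g = 0`.  The functional-analytic content certified here: shape (a) has a REMOVABLE
SINGULARITY at `g = 0` — it is `O(g)`, tends to `0`, and (in `ℂ`) is analytic through `g = 0` with value `0` — and
shapes (b), (c) are analytic in `g` near `0` with value `0` at `g = 0`; hence so is their sum.  (The term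
`log σ(gCB − hD̃(gCB))` is not typed: `σ` is not defined on these pages.)

THE TYPING (schematic, continuing `B12Lineariz267` … `B12JacobianTrLog268`; cell DIVERGENCE row for this file).
`𝒴`, `𝒳` complex Banach spaces (bond configurations on `T⁽ᵏ⁾`, `T⁽ᵏ⁺¹⁾`), `hop : 𝒳 →ₗ[ℂ] 𝒴` (print's `h`) with
`‖hop X‖ ≤ b‖X‖`, `Ct : 𝒴 → 𝒳` (print's `C̃`) with `QuadAnalytic Ct C₂ R` and `AnalyticOnNhd ℂ Ct {‖Y‖ < R}`,
`3ε ≤ R`, `9C₂bε < 1` (`≤ 1/2` where the `Tr log` term enters), `0 < ε`; `D̃` HYPOTHESIS-STYLE (`hDball`, `hDfix`).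
The coupling is `g : ℂ` (real couplings by restriction, `tendsto_inv_sq_smul_real`); the fixed direction `X : 𝒴`
stands for `CB` (resp. `B` in the `G₃` term); `D̃₃(Y) = Dt Y − 2⁻¹ • D²C̃(0)(Y, Y)` as in `B12SecondOrder267`; the
pairings `⟨H₁h·, J⟩`, `⟨H₁·, Δ₁H₁h·⟩`, `⟨H₁h·, Δ₁H₁h·⟩` are arbitrary continuous (bi)linear maps `ℓ`, `β`, `q`;
`V : 𝒲 → 𝒵` is any function with `V = O(‖W‖³)` at `0`, analytic near `0`, composed with a continuous linear
`H₁ : 𝒴 →L[ℂ] 𝒲`; `G₃ : 𝒴 → 𝒵` any `O(‖B‖³)` function differentiable near `0`; the curly bracket is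
`E(Φ(gX)) − E(0)` for any `E : 𝒴 → 𝒵` analytic at `0` (absorbing `U_k`, `exp i[·]`, `V⁽ᵏ⁾`, `E_k`); the `Tr log`
term is `LinearMap.trace ℂ 𝒴 (mlog (1 − J(gX)))`, `J(Y) = hop.mkContinuous b hHop ∘L fderiv ℂ Dt Y`
(`B12JacobianTrLog268`, finite-dimensional `𝒴`).  Lean's conventions `0⁻¹ = 0` make `g ↦ (g²)⁻¹ • F(g • X)` the
function already EXTENDED BY `0` at `g = 0`, which is the print's «vanishes at g_k = 0»; the theorems say this value
is the continuous ∕ analytic one.  No definitions are introduced.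

CONTENTS.  §1 [folklore] GENERIC REMOVABLE SINGULARITY IN THE COUPLING, for `F : 𝒴 → 𝒵` between complex normed
spaces and `φ_X(g) := (g²)⁻¹ • F(g • X)`: `φ_X(0) = 0`; if `F = O(‖Y‖³)` at `0` then `g ↦ F(g • X) = O(|g|³)`,
`φ_X = O(g)` (an eventual bound `‖φ_X(g)‖ ≤ C|g|`), `φ_X → 0` as `g → 0` (also along real `g`), `φ_X` continuous at
`0`; the EXPLICIT form `‖F(Y)‖ ≤ C₃‖Y‖³` on `ball 0 r` ⇒ `‖φ_X(g)‖ ≤ C₃|g|‖X‖³` for `|g|‖X‖ < r`; if moreover `F` is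
differentiable near `0` (`𝒵` complete) then `φ_X` is ANALYTIC AT `g = 0` (Mathlib's removable-singularity theorem
`Complex.analyticAt_of_differentiable_on_punctured_nhds_of_continuousAt` BY NAME), and if `F` is analytic on
`ball 0 r` then `φ_X` is analytic on the disc `|g|‖X‖ < r`; evaluation `Y ↦ f(Y)(u(Y))` of analytic maps is analytic.
§2 [folklore] THE SHARES OF THE DISPLAYED TERMS for the hypothesis-style `D̃`: `‖Φ(Y)‖ ≤ 2‖Y‖` and `D̃ = O(‖Y‖²)`;
the `D̃₃`-term `(g²)⁻¹ • ℓ(D̃₃(gX))` (analytic on the disc `|g|‖X‖ < ε`, `→ 0`); the bilinear term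
`(g²)⁻¹ • β(gX)(D̃(gX))` and the quadratic term `(g²)⁻¹ • q(D̃(gX))(D̃(gX))` (`O(‖Y‖³)` on the ball, analytic, hence
the same); the `V`-term `(g²)⁻¹ • V(H₁Φ(gX))` (`V ∘ H₁ ∘ Φ = O(‖Y‖³)` and differentiable near `0`, hence analytic at
`g = 0`, `→ 0`); the curly bracket `E(Φ(gX)) − E(0)` (analytic at `g = 0`, value `0`); the `Tr log` term (analytic on
the disc `|g|‖X‖ < ε`, value `0` at `g = 0`, `→ 0`).  §3 ONE transcription theorem [cite] for the schematic exponent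
`P(g)` = the signed sum of the seven typed terms: `P` is analytic at `g = 0`, `P(0) = 0`, `P(g) → 0`; and a
degenerate model showing the hypotheses are jointly satisfiable.  NOT TYPED: the term `log σ(…)`; the integral
`∫ dμ_{C⁽ᵏ⁾}(B) χ_k exp[…]`, its logarithm (2.13) and the statement (2.14) about `N_k″` (measure theory on the
lattice spaces); uniformity of the `O(g)` bounds in the field `B`, in `U_{k+1}` and in the scale, and the bounds on
derivatives (p. 264) — the β-function-level reading of «vanishes at g_k = 0» stays the HYPOTHESIS
`B12Beta.OneLoopSplit.vanish` of the tree; the concrete lattice objects (`h`, `H₁`, `Δ₁`, `J`, `C`, `G₃`, `V`, `E_k`).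
Everything is [folklore] one-variable complex analysis ∕ asymptotics except §3; nothing of [B12] is asserted; NOT
summit progress.
-/

open Metric Set Filter Topology Asymptotics

namespace Literature.MathematicalPhysics.QuantumFieldTheory.Balaban1983to89.B12ZeroCoupling268

open Literature.MathematicalPhysics.QuantumFieldTheory.Balaban1983to89.B13Contraction113
open Literature.MathematicalPhysics.QuantumFieldTheory.Balaban1983to89.B12Lineariz267
open Literature.MathematicalPhysics.QuantumFieldTheory.Balaban1983to89.B12LinearizAnalytic267
open Literature.MathematicalPhysics.QuantumFieldTheory.Balaban1983to89.B12SecondOrder267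
open Literature.MathematicalPhysics.QuantumFieldTheory.Balaban1983to89.MatrixLog
open Literature.MathematicalPhysics.QuantumFieldTheory.Balaban1983to89.B12JacobianTrLog268

/-! ## §1  Generic: the removable singularity of `g ↦ (g²)⁻¹ • F(g • X)` at `g = 0` -/
section generic

variable {𝒴 𝒵 : Type*} [NormedAddCommGroup 𝒴] [NormedSpace ℂ 𝒴]
  [NormedAddCommGroup 𝒵] [NormedSpace ℂ 𝒵]

/-- **The value at `g = 0` is `0`** — by Lean's convention `0⁻¹ = 0` the rescaled term is already the function
extended by `0` at zero coupling (print: «vanishes at g_k = 0»). [folklore] -/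
theorem inv_sq_smul_apply_zero (F : 𝒴 → 𝒵) (X : 𝒴) :
    (fun g : ℂ => (g ^ 2)⁻¹ • F (g • X)) 0 = 0 := by simp

/-- The scaling map `g ↦ g • X` («B = g_kB′») tends to `0` with the coupling. [folklore] -/
theorem tendsto_smul_const_zero (X : 𝒴) : Tendsto (fun g : ℂ => g • X) (𝓝 0) (𝓝 0) := by
  have h : Tendsto (fun g : ℂ => g • X) (𝓝 0) (𝓝 ((0:ℂ) • X)) :=
    (continuous_id.smul continuous_const).tendsto 0
  rwa [zero_smul] at h

omit [NormedSpace ℂ 𝒵] in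
/-- `F = O(‖Y‖³)` at `0` ⇒ `g ↦ F(g • X) = O(|g|³)` at `g = 0`. [folklore] -/
theorem isBigO_comp_smul {F : 𝒴 → 𝒵} (hF : F =O[𝓝 (0:𝒴)] fun Y => ‖Y‖ ^ 3) (X : 𝒴) :
    (fun g : ℂ => F (g • X)) =O[𝓝 (0:ℂ)] fun g : ℂ => ‖g‖ ^ 3 := by
  refine (hF.comp_tendsto (tendsto_smul_const_zero X)).trans
    (IsBigO.of_bound (‖X‖ ^ 3) (Eventually.of_forall fun g => ?_))
  simp only [Function.comp_apply, norm_smul, mul_pow]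
  rw [Real.norm_of_nonneg (by positivity), Real.norm_of_nonneg (by positivity), mul_comm]

/-- **`(g²)⁻¹ • F(g • X) = O(g)`** at `g = 0` when `F = O(‖Y‖³)`. [folklore] -/
theorem isBigO_inv_sq_smul {F : 𝒴 → 𝒵} (hF : F =O[𝓝 (0:𝒴)] fun Y => ‖Y‖ ^ 3) (X : 𝒴) :
    (fun g : ℂ => (g ^ 2)⁻¹ • F (g • X)) =O[𝓝 (0:ℂ)] fun g => g := by
  obtain ⟨C, hC⟩ := (isBigO_comp_smul hF X).bound
  refine IsBigO.of_bound C ?_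
  filter_upwards [hC] with g hg
  rw [Real.norm_of_nonneg (by positivity)] at hg
  rcases eq_or_ne g 0 with rfl | hg0
  · simp
  have hg0' : (0:ℝ) < ‖g‖ := norm_pos_iff.mpr hg0
  rw [norm_smul, norm_inv, norm_pow]
  calc (‖g‖ ^ 2)⁻¹ * ‖F (g • X)‖ ≤ (‖g‖ ^ 2)⁻¹ * (C * ‖g‖ ^ 3) := by gcongr
    _ = C * ‖g‖ := by field_simp

/-- The same as an eventual LINEAR BOUND `‖(g²)⁻¹ • F(g • X)‖ ≤ C|g|` near `g = 0` (the term-level shape of a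
Lipschitz-at-`0` dependence on the coupling). [folklore] -/
theorem eventually_norm_inv_sq_smul_le {F : 𝒴 → 𝒵} (hF : F =O[𝓝 (0:𝒴)] fun Y => ‖Y‖ ^ 3) (X : 𝒴) :
    ∃ C, ∀ᶠ g : ℂ in 𝓝 0, ‖(g ^ 2)⁻¹ • F (g • X)‖ ≤ C * ‖g‖ :=
  (isBigO_inv_sq_smul hF X).bound

/-- **`(g²)⁻¹ • F(g • X) → 0` as `g → 0`** («vanishes at g_k = 0» as a limit). [folklore] -/
theorem tendsto_inv_sq_smul {F : 𝒴 → 𝒵} (hF : F =O[𝓝 (0:𝒴)] fun Y => ‖Y‖ ^ 3) (X : 𝒴) :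
    Tendsto (fun g : ℂ => (g ^ 2)⁻¹ • F (g • X)) (𝓝 0) (𝓝 0) :=
  (isBigO_inv_sq_smul hF X).trans_tendsto tendsto_id

/-- Hence the rescaled term (value `0` at `0`) is CONTINUOUS at `g = 0`. [folklore] -/
theorem continuousAt_inv_sq_smul {F : 𝒴 → 𝒵} (hF : F =O[𝓝 (0:𝒴)] fun Y => ‖Y‖ ^ 3) (X : 𝒴) :
    ContinuousAt (fun g : ℂ => (g ^ 2)⁻¹ • F (g • X)) 0 := by
  have h := tendsto_inv_sq_smul hF X
  rw [ContinuousAt]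
  simpa using h

/-- The limit along REAL couplings `g ∈ ℝ` (the print's `0 < g_k ≤ γ`). [folklore] -/
theorem tendsto_inv_sq_smul_real {F : 𝒴 → 𝒵} (hF : F =O[𝓝 (0:𝒴)] fun Y => ‖Y‖ ^ 3) (X : 𝒴) :
    Tendsto (fun g : ℝ => ((g:ℂ) ^ 2)⁻¹ • F ((g:ℂ) • X)) (𝓝 0) (𝓝 0) :=
  (tendsto_inv_sq_smul hF X).comp (Complex.continuous_ofReal.tendsto' 0 0 (by simp))

/-- **EXPLICIT form**: `‖F(Y)‖ ≤ C₃‖Y‖³` on `ball 0 r` ⇒ `‖(g²)⁻¹ • F(g • X)‖ ≤ C₃|g|‖X‖³` whenever `|g|‖X‖ < r`.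
[folklore] -/
theorem norm_inv_sq_smul_le {F : 𝒴 → 𝒵} {C₃ r : ℝ}
    (hF : ∀ Y ∈ ball (0:𝒴) r, ‖F Y‖ ≤ C₃ * ‖Y‖ ^ 3) {g : ℂ} {X : 𝒴} (hg : ‖g‖ * ‖X‖ < r) :
    ‖(g ^ 2)⁻¹ • F (g • X)‖ ≤ C₃ * ‖g‖ * ‖X‖ ^ 3 := by
  rcases eq_or_ne g 0 with rfl | hg0
  · simp
  have hmem : g • X ∈ ball (0:𝒴) r := by rw [mem_ball_zero_iff, norm_smul]; exact hg
  have h := hF _ hmem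
  rw [norm_smul] at h
  have hg0' : (0:ℝ) < ‖g‖ := norm_pos_iff.mpr hg0
  rw [norm_smul, norm_inv, norm_pow]
  calc (‖g‖ ^ 2)⁻¹ * ‖F (g • X)‖ ≤ (‖g‖ ^ 2)⁻¹ * (C₃ * (‖g‖ * ‖X‖) ^ 3) := by gcongr
    _ = C₃ * ‖g‖ * ‖X‖ ^ 3 := by field_simp

/-- Evaluation `Y ↦ f(Y)(u(Y))` of an analytic operator-valued map at an analytic vector-valued map is analytic
(evaluation is a continuous bilinear map; Mathlib `ContinuousLinearMap.analyticAt_bilinear` + `AnalyticAt.comp₂`).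
The tree has the curve case as `AnalyticAt.clm_apply_analyticAt`
(`Literature.Analysis.OperatorTheory.CompactSelfAdjointResolvent`, not imported). [folklore] -/
theorem analyticAt_clm_apply {𝒳' : Type*} [NormedAddCommGroup 𝒳'] [NormedSpace ℂ 𝒳']
    {f : 𝒴 → 𝒳' →L[ℂ] 𝒵} {u : 𝒴 → 𝒳'} {Y : 𝒴}
    (hf : AnalyticAt ℂ f Y) (hu : AnalyticAt ℂ u Y) : AnalyticAt ℂ (fun Y => f Y (u Y)) Y :=
  ((ContinuousLinearMap.id ℂ (𝒳' →L[ℂ] 𝒵)).analyticAt_bilinear (f Y, u Y)).comp₂ hf hu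

variable [CompleteSpace 𝒵]

/-- **REMOVABLE SINGULARITY: `g ↦ (g²)⁻¹ • F(g • X)` is ANALYTIC AT `g = 0`** when `F = O(‖Y‖³)` at `0` and `F`
is (complex-)differentiable near `0`: off `0` it is a product of differentiable functions, at `0` it is continuous
(value `0`), and Mathlib's `Complex.analyticAt_of_differentiable_on_punctured_nhds_of_continuousAt` (Riemann's
theorem on removable singularities) applies. [folklore] -/
theorem analyticAt_inv_sq_smul {F : 𝒴 → 𝒵} (hF : F =O[𝓝 (0:𝒴)] fun Y => ‖Y‖ ^ 3)
    (hFd : ∀ᶠ Y in 𝓝 (0:𝒴), DifferentiableAt ℂ F Y) (X : 𝒴) :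
    AnalyticAt ℂ (fun g : ℂ => (g ^ 2)⁻¹ • F (g • X)) 0 := by
  apply Complex.analyticAt_of_differentiable_on_punctured_nhds_of_continuousAt
  · have h1 : ∀ᶠ g in 𝓝 (0:ℂ), DifferentiableAt ℂ F (g • X) := (tendsto_smul_const_zero X).eventually hFd
    filter_upwards [nhdsWithin_le_nhds h1, self_mem_nhdsWithin] with g hg hg0
    have hsc : DifferentiableAt ℂ (fun g : ℂ => g • X) g := differentiableAt_id.smul_const X
    have hinv : DifferentiableAt ℂ (fun g : ℂ => (g ^ 2)⁻¹) g :=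
      (differentiableAt_pow 2).inv (pow_ne_zero 2 hg0)
    exact hinv.smul (hg.comp g hsc)
  · exact continuousAt_inv_sq_smul hF X

/-- **… and ANALYTIC ON THE DISC `|g|‖X‖ < r`** when `F` is analytic on `ball 0 r` (`0 < r`) and `O(‖Y‖³)` at `0`.
[folklore] -/
theorem analyticOnNhd_inv_sq_smul {F : 𝒴 → 𝒵} {r : ℝ} (hr : 0 < r)
    (hFa : AnalyticOnNhd ℂ F (ball (0:𝒴) r)) (hF : F =O[𝓝 (0:𝒴)] fun Y => ‖Y‖ ^ 3) (X : 𝒴) :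
    AnalyticOnNhd ℂ (fun g : ℂ => (g ^ 2)⁻¹ • F (g • X)) {g : ℂ | ‖g‖ * ‖X‖ < r} := by
  intro g hg
  rcases eq_or_ne g 0 with rfl | hg0
  · refine analyticAt_inv_sq_smul hF ?_ X
    filter_upwards [isOpen_ball.mem_nhds (mem_ball_self hr)] with Y hY
    exact (hFa Y hY).differentiableAt
  · have hmem : g • X ∈ ball (0:𝒴) r := by rw [mem_ball_zero_iff, norm_smul]; exact hg
    have hsc : AnalyticAt ℂ (fun g : ℂ => g • X) g := analyticAt_id.smul analyticAt_const
    have hinv : AnalyticAt ℂ (fun g : ℂ => (g ^ 2)⁻¹) g := (analyticAt_id.pow 2).inv (pow_ne_zero 2 hg0)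
    exact hinv.smul ((hFa _ hmem).comp_of_eq hsc rfl)

end generic

/-! ## §2  The shares of the displayed terms of (2.12) -/
section shares

variable {𝒳 𝒴 𝒵 𝒲 : Type*} [NormedAddCommGroup 𝒳] [NormedSpace ℂ 𝒳] [CompleteSpace 𝒳]
  [NormedAddCommGroup 𝒴] [NormedSpace ℂ 𝒴] [CompleteSpace 𝒴]
  [NormedAddCommGroup 𝒵] [NormedSpace ℂ 𝒵]
  [NormedAddCommGroup 𝒲] [NormedSpace ℂ 𝒲]
  {hop : 𝒳 →ₗ[ℂ] 𝒴} {Ct : 𝒴 → 𝒳} {C₂ R b ε : ℝ} {Dt : 𝒴 → 𝒳}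

omit [CompleteSpace 𝒴] in
/-- `‖Φ(Y)‖ ≤ 2‖Y‖` on `‖Y‖ < ε` (`‖hD̃(Y)‖ ≤ 4C₂b‖Y‖²`, `B12Lineariz267.norm_hop_Dt_le`, and `4C₂bε ≤ 1`): the
field `gCB − hD̃(gCB)` is `O(g)`. [folklore] -/
theorem norm_phi_le_two_mul (hC : QuadAnalytic Ct C₂ R) (hC₂ : 0 ≤ C₂) (hb : 0 ≤ b)
    (hHop : ∀ X, ‖hop X‖ ≤ b * ‖X‖) (hq : 9 * C₂ * b * ε < 1) (hRC : 3 * ε ≤ R)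
    (hDball : ∀ B : 𝒴, ‖B‖ < ε → Dt B ∈ closedBall (0:𝒳) (4 * C₂ * ε ^ 2))
    (hDfix : ∀ B : 𝒴, ‖B‖ < ε → Ct (B - hop (Dt B)) = Dt B) {Y : 𝒴} (hY : ‖Y‖ < ε) :
    ‖Y - hop (Dt Y)‖ ≤ 2 * ‖Y‖ := by
  have h1 := (norm_hop_Dt_le hC hC₂ hb hHop hq hRC hDball hDfix hY).1
  have hε : 0 ≤ ε := (norm_nonneg _).trans hY.le
  have h9 : 0 ≤ 9 * C₂ * b := by positivity
  have h2 : 4 * C₂ * b * ‖Y‖ ^ 2 ≤ ‖Y‖ := by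
    have h3 : 4 * C₂ * b * ‖Y‖ ≤ 1 := by nlinarith [mul_nonneg h9 hε, norm_nonneg Y]
    nlinarith [norm_nonneg Y]
  calc ‖Y - hop (Dt Y)‖ ≤ ‖Y‖ + ‖hop (Dt Y)‖ := norm_sub_le _ _
    _ ≤ 2 * ‖Y‖ := by linarith

omit [CompleteSpace 𝒴] in
/-- **«D̃(B) has an expansion beginning with quadratic terms»** as `D̃ = O(‖Y‖²)` at `0`
(`B12Lineariz267.norm_Dt_le`). [folklore] -/
theorem isBigO_Dt_sq (hC : QuadAnalytic Ct C₂ R) (hC₂ : 0 ≤ C₂) (hb : 0 ≤ b)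
    (hHop : ∀ X, ‖hop X‖ ≤ b * ‖X‖) (hq : 9 * C₂ * b * ε < 1) (hRC : 3 * ε ≤ R)
    (hDball : ∀ B : 𝒴, ‖B‖ < ε → Dt B ∈ closedBall (0:𝒳) (4 * C₂ * ε ^ 2))
    (hDfix : ∀ B : 𝒴, ‖B‖ < ε → Ct (B - hop (Dt B)) = Dt B) (hε : 0 < ε) :
    Dt =O[𝓝 (0:𝒴)] fun Y => ‖Y‖ ^ 2 := by
  refine IsBigO.of_bound (4 * C₂) ?_
  filter_upwards [isOpen_ball.mem_nhds (mem_ball_self hε)] with Y hY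
  rw [Real.norm_of_nonneg (by positivity)]
  exact norm_Dt_le hC hC₂ hb hHop hq hRC hDball hDfix (mem_ball_zero_iff.mp hY)

/-! ### The `D̃₃`-term «(1/g_k²)⟨H₁hD̃₃(g_kCB), J⟩» -/

/-- `ℓ ∘ D̃₃ = O(‖Y‖³)` at `0` for every continuous linear `ℓ` (`B12SecondOrder267.isBigO_Dt3`). [folklore] -/
theorem isBigO_ell_Dt3 (hC : QuadAnalytic Ct C₂ R) (hCa : AnalyticOnNhd ℂ Ct {Y : 𝒴 | ‖Y‖ < R})
    (hC₂ : 0 ≤ C₂) (hb : 0 ≤ b) (hHop : ∀ X, ‖hop X‖ ≤ b * ‖X‖) (hq : 9 * C₂ * b * ε < 1)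
    (hRC : 3 * ε ≤ R) (hDball : ∀ B : 𝒴, ‖B‖ < ε → Dt B ∈ closedBall (0:𝒳) (4 * C₂ * ε ^ 2))
    (hDfix : ∀ B : 𝒴, ‖B‖ < ε → Ct (B - hop (Dt B)) = Dt B) (hε : 0 < ε) (ℓ : 𝒳 →L[ℂ] 𝒵) :
    (fun Y => ℓ (Dt Y - (2:ℂ)⁻¹ • iteratedFDeriv ℂ 2 Ct 0 (fun _ => Y))) =O[𝓝 (0:𝒴)] fun Y => ‖Y‖ ^ 3 :=
  (ℓ.isBigO_comp _ _).trans (isBigO_Dt3 hC hCa hC₂ hb hHop hq hRC hDball hDfix hε)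

/-- `ℓ ∘ D̃₃` is analytic on the ball (`B12SecondOrder267.analyticOnNhd_Dt3`). [folklore] -/
theorem analyticOnNhd_ell_Dt3 (hC : QuadAnalytic Ct C₂ R) (hCa : AnalyticOnNhd ℂ Ct {Y : 𝒴 | ‖Y‖ < R})
    (hC₂ : 0 ≤ C₂) (hb : 0 ≤ b) (hHop : ∀ X, ‖hop X‖ ≤ b * ‖X‖) (hq : 9 * C₂ * b * ε < 1)
    (hRC : 3 * ε ≤ R) (hDball : ∀ B : 𝒴, ‖B‖ < ε → Dt B ∈ closedBall (0:𝒳) (4 * C₂ * ε ^ 2))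
    (hDfix : ∀ B : 𝒴, ‖B‖ < ε → Ct (B - hop (Dt B)) = Dt B) (ℓ : 𝒳 →L[ℂ] 𝒵) :
    AnalyticOnNhd ℂ (fun Y => ℓ (Dt Y - (2:ℂ)⁻¹ • iteratedFDeriv ℂ 2 Ct 0 (fun _ => Y))) (ball (0:𝒴) ε) :=
  fun Y hY => (ℓ.analyticAt _).comp_of_eq (analyticOnNhd_Dt3 hC hCa hC₂ hb hHop hq hRC hDball hDfix Y hY) rfl

/-- **The `D̃₃`-term `g ↦ (g²)⁻¹ • ℓ(D̃₃(gX))` is ANALYTIC on the disc `|g|‖X‖ < ε`, through `g = 0`.** [folklore] -/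
theorem analyticOnNhd_scaled_Dt3 [CompleteSpace 𝒵] (hC : QuadAnalytic Ct C₂ R)
    (hCa : AnalyticOnNhd ℂ Ct {Y : 𝒴 | ‖Y‖ < R})
    (hC₂ : 0 ≤ C₂) (hb : 0 ≤ b) (hHop : ∀ X, ‖hop X‖ ≤ b * ‖X‖) (hq : 9 * C₂ * b * ε < 1)
    (hRC : 3 * ε ≤ R) (hDball : ∀ B : 𝒴, ‖B‖ < ε → Dt B ∈ closedBall (0:𝒳) (4 * C₂ * ε ^ 2))
    (hDfix : ∀ B : 𝒴, ‖B‖ < ε → Ct (B - hop (Dt B)) = Dt B) (hε : 0 < ε) (ℓ : 𝒳 →L[ℂ] 𝒵) (X : 𝒴) :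
    AnalyticOnNhd ℂ (fun g : ℂ => (g ^ 2)⁻¹ •
      ℓ (Dt (g • X) - (2:ℂ)⁻¹ • iteratedFDeriv ℂ 2 Ct 0 (fun _ => g • X))) {g : ℂ | ‖g‖ * ‖X‖ < ε} :=
  analyticOnNhd_inv_sq_smul hε (analyticOnNhd_ell_Dt3 hC hCa hC₂ hb hHop hq hRC hDball hDfix ℓ)
    (isBigO_ell_Dt3 hC hCa hC₂ hb hHop hq hRC hDball hDfix hε ℓ) X

/-- The `D̃₃`-term tends to `0` with the coupling (print: `D̃₃(g_kCB)/g_k² = O(g_k)`). [folklore] -/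
theorem tendsto_scaled_Dt3 (hC : QuadAnalytic Ct C₂ R) (hCa : AnalyticOnNhd ℂ Ct {Y : 𝒴 | ‖Y‖ < R})
    (hC₂ : 0 ≤ C₂) (hb : 0 ≤ b) (hHop : ∀ X, ‖hop X‖ ≤ b * ‖X‖) (hq : 9 * C₂ * b * ε < 1)
    (hRC : 3 * ε ≤ R) (hDball : ∀ B : 𝒴, ‖B‖ < ε → Dt B ∈ closedBall (0:𝒳) (4 * C₂ * ε ^ 2))
    (hDfix : ∀ B : 𝒴, ‖B‖ < ε → Ct (B - hop (Dt B)) = Dt B) (hε : 0 < ε) (ℓ : 𝒳 →L[ℂ] 𝒵) (X : 𝒴) :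
    Tendsto (fun g : ℂ => (g ^ 2)⁻¹ •
      ℓ (Dt (g • X) - (2:ℂ)⁻¹ • iteratedFDeriv ℂ 2 Ct 0 (fun _ => g • X))) (𝓝 0) (𝓝 0) :=
  tendsto_inv_sq_smul (isBigO_ell_Dt3 hC hCa hC₂ hb hHop hq hRC hDball hDfix hε ℓ) X

/-! ### The bilinear term «(1/g_k²)⟨H₁g_kCB, Δ₁H₁hD̃(g_kCB)⟩» and the quadratic term
«(1/g_k²)⟨H₁hD̃(g_kCB), Δ₁H₁hD̃(g_kCB)⟩» -/

omit [CompleteSpace 𝒴] in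
/-- `Y ↦ β(Y)(D̃(Y)) = O(‖Y‖³)` at `0` for a continuous bilinear `β` (`‖β‖·‖Y‖·4C₂‖Y‖²`). [folklore] -/
theorem isBigO_bilin_Dt (hC : QuadAnalytic Ct C₂ R) (hC₂ : 0 ≤ C₂) (hb : 0 ≤ b)
    (hHop : ∀ X, ‖hop X‖ ≤ b * ‖X‖) (hq : 9 * C₂ * b * ε < 1) (hRC : 3 * ε ≤ R)
    (hDball : ∀ B : 𝒴, ‖B‖ < ε → Dt B ∈ closedBall (0:𝒳) (4 * C₂ * ε ^ 2))
    (hDfix : ∀ B : 𝒴, ‖B‖ < ε → Ct (B - hop (Dt B)) = Dt B) (hε : 0 < ε) (β : 𝒴 →L[ℂ] 𝒳 →L[ℂ] 𝒵) :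
    (fun Y => β Y (Dt Y)) =O[𝓝 (0:𝒴)] fun Y => ‖Y‖ ^ 3 := by
  refine IsBigO.of_bound (‖β‖ * (4 * C₂)) ?_
  filter_upwards [isOpen_ball.mem_nhds (mem_ball_self hε)] with Y hY
  rw [Real.norm_of_nonneg (by positivity)]
  have hD := norm_Dt_le hC hC₂ hb hHop hq hRC hDball hDfix (mem_ball_zero_iff.mp hY)
  calc ‖β Y (Dt Y)‖ ≤ ‖β Y‖ * ‖Dt Y‖ := (β Y).le_opNorm _
    _ ≤ (‖β‖ * ‖Y‖) * (4 * C₂ * ‖Y‖ ^ 2) := by gcongr; exact β.le_opNorm Y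
    _ = ‖β‖ * (4 * C₂) * ‖Y‖ ^ 3 := by ring

/-- `Y ↦ β(Y)(D̃(Y))` is analytic on the ball. [folklore] -/
theorem analyticOnNhd_bilin_Dt (hC : QuadAnalytic Ct C₂ R) (hCa : AnalyticOnNhd ℂ Ct {Y : 𝒴 | ‖Y‖ < R})
    (hC₂ : 0 ≤ C₂) (hb : 0 ≤ b) (hHop : ∀ X, ‖hop X‖ ≤ b * ‖X‖) (hq : 9 * C₂ * b * ε < 1)
    (hRC : 3 * ε ≤ R) (hDball : ∀ B : 𝒴, ‖B‖ < ε → Dt B ∈ closedBall (0:𝒳) (4 * C₂ * ε ^ 2))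
    (hDfix : ∀ B : 𝒴, ‖B‖ < ε → Ct (B - hop (Dt B)) = Dt B) (β : 𝒴 →L[ℂ] 𝒳 →L[ℂ] 𝒵) :
    AnalyticOnNhd ℂ (fun Y => β Y (Dt Y)) (ball (0:𝒴) ε) := fun Y hY =>
  analyticAt_clm_apply (β.analyticAt Y)
    (analyticAt_Dt hC hCa hC₂ hb hHop hq hRC hDball hDfix (mem_ball_zero_iff.mp hY))

/-- **The bilinear term `g ↦ (g²)⁻¹ • β(gX)(D̃(gX))` is analytic on the disc `|g|‖X‖ < ε` and tends to `0`.**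
[folklore] -/
theorem analyticOnNhd_scaled_bilin [CompleteSpace 𝒵] (hC : QuadAnalytic Ct C₂ R)
    (hCa : AnalyticOnNhd ℂ Ct {Y : 𝒴 | ‖Y‖ < R})
    (hC₂ : 0 ≤ C₂) (hb : 0 ≤ b) (hHop : ∀ X, ‖hop X‖ ≤ b * ‖X‖) (hq : 9 * C₂ * b * ε < 1)
    (hRC : 3 * ε ≤ R) (hDball : ∀ B : 𝒴, ‖B‖ < ε → Dt B ∈ closedBall (0:𝒳) (4 * C₂ * ε ^ 2))
    (hDfix : ∀ B : 𝒴, ‖B‖ < ε → Ct (B - hop (Dt B)) = Dt B) (hε : 0 < ε) (β : 𝒴 →L[ℂ] 𝒳 →L[ℂ] 𝒵) (X : 𝒴) :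
    AnalyticOnNhd ℂ (fun g : ℂ => (g ^ 2)⁻¹ • β (g • X) (Dt (g • X))) {g : ℂ | ‖g‖ * ‖X‖ < ε} ∧
      Tendsto (fun g : ℂ => (g ^ 2)⁻¹ • β (g • X) (Dt (g • X))) (𝓝 0) (𝓝 0) :=
  ⟨analyticOnNhd_inv_sq_smul hε (analyticOnNhd_bilin_Dt hC hCa hC₂ hb hHop hq hRC hDball hDfix β)
      (isBigO_bilin_Dt hC hC₂ hb hHop hq hRC hDball hDfix hε β) X,
    tendsto_inv_sq_smul (isBigO_bilin_Dt hC hC₂ hb hHop hq hRC hDball hDfix hε β) X⟩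

omit [CompleteSpace 𝒴] in
/-- `Y ↦ q(D̃(Y))(D̃(Y)) = O(‖Y‖⁴) ⊆ O(‖Y‖³)` at `0` (on the ball `‖Y‖⁴ ≤ ε‖Y‖³`). [folklore] -/
theorem isBigO_quad_Dt (hC : QuadAnalytic Ct C₂ R) (hC₂ : 0 ≤ C₂) (hb : 0 ≤ b)
    (hHop : ∀ X, ‖hop X‖ ≤ b * ‖X‖) (hq : 9 * C₂ * b * ε < 1) (hRC : 3 * ε ≤ R)
    (hDball : ∀ B : 𝒴, ‖B‖ < ε → Dt B ∈ closedBall (0:𝒳) (4 * C₂ * ε ^ 2))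
    (hDfix : ∀ B : 𝒴, ‖B‖ < ε → Ct (B - hop (Dt B)) = Dt B) (hε : 0 < ε) (q : 𝒳 →L[ℂ] 𝒳 →L[ℂ] 𝒵) :
    (fun Y => q (Dt Y) (Dt Y)) =O[𝓝 (0:𝒴)] fun Y => ‖Y‖ ^ 3 := by
  refine IsBigO.of_bound (‖q‖ * (4 * C₂) * (4 * C₂ * ε)) ?_
  filter_upwards [isOpen_ball.mem_nhds (mem_ball_self hε)] with Y hY
  rw [mem_ball_zero_iff] at hY
  rw [Real.norm_of_nonneg (by positivity)]
  have hD := norm_Dt_le hC hC₂ hb hHop hq hRC hDball hDfix hY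
  have hY4 : ‖Y‖ ^ 4 ≤ ε * ‖Y‖ ^ 3 := by
    have := norm_nonneg Y
    nlinarith [pow_nonneg this 3]
  calc ‖q (Dt Y) (Dt Y)‖ ≤ ‖q (Dt Y)‖ * ‖Dt Y‖ := (q (Dt Y)).le_opNorm _
    _ ≤ (‖q‖ * (4 * C₂ * ‖Y‖ ^ 2)) * (4 * C₂ * ‖Y‖ ^ 2) := by
        gcongr; exact (q.le_opNorm _).trans (by gcongr)
    _ = ‖q‖ * (4 * C₂) * (4 * C₂) * ‖Y‖ ^ 4 := by ring
    _ ≤ ‖q‖ * (4 * C₂) * (4 * C₂) * (ε * ‖Y‖ ^ 3) := by gcongr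
    _ = ‖q‖ * (4 * C₂) * (4 * C₂ * ε) * ‖Y‖ ^ 3 := by ring

/-- `Y ↦ q(D̃(Y))(D̃(Y))` is analytic on the ball. [folklore] -/
theorem analyticOnNhd_quad_Dt (hC : QuadAnalytic Ct C₂ R) (hCa : AnalyticOnNhd ℂ Ct {Y : 𝒴 | ‖Y‖ < R})
    (hC₂ : 0 ≤ C₂) (hb : 0 ≤ b) (hHop : ∀ X, ‖hop X‖ ≤ b * ‖X‖) (hq : 9 * C₂ * b * ε < 1)
    (hRC : 3 * ε ≤ R) (hDball : ∀ B : 𝒴, ‖B‖ < ε → Dt B ∈ closedBall (0:𝒳) (4 * C₂ * ε ^ 2))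
    (hDfix : ∀ B : 𝒴, ‖B‖ < ε → Ct (B - hop (Dt B)) = Dt B) (q : 𝒳 →L[ℂ] 𝒳 →L[ℂ] 𝒵) :
    AnalyticOnNhd ℂ (fun Y => q (Dt Y) (Dt Y)) (ball (0:𝒴) ε) := fun Y hY => by
  have hD := analyticAt_Dt hC hCa hC₂ hb hHop hq hRC hDball hDfix (mem_ball_zero_iff.mp hY)
  exact analyticAt_clm_apply ((q.analyticAt (Dt Y)).comp_of_eq hD rfl) hD

/-- **The quadratic term `g ↦ (g²)⁻¹ • q(D̃(gX))(D̃(gX))` is analytic on the disc `|g|‖X‖ < ε` and tends to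
`0`.** [folklore] -/
theorem analyticOnNhd_scaled_quad [CompleteSpace 𝒵] (hC : QuadAnalytic Ct C₂ R)
    (hCa : AnalyticOnNhd ℂ Ct {Y : 𝒴 | ‖Y‖ < R})
    (hC₂ : 0 ≤ C₂) (hb : 0 ≤ b) (hHop : ∀ X, ‖hop X‖ ≤ b * ‖X‖) (hq : 9 * C₂ * b * ε < 1)
    (hRC : 3 * ε ≤ R) (hDball : ∀ B : 𝒴, ‖B‖ < ε → Dt B ∈ closedBall (0:𝒳) (4 * C₂ * ε ^ 2))
    (hDfix : ∀ B : 𝒴, ‖B‖ < ε → Ct (B - hop (Dt B)) = Dt B) (hε : 0 < ε) (q : 𝒳 →L[ℂ] 𝒳 →L[ℂ] 𝒵) (X : 𝒴) :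
    AnalyticOnNhd ℂ (fun g : ℂ => (g ^ 2)⁻¹ • q (Dt (g • X)) (Dt (g • X))) {g : ℂ | ‖g‖ * ‖X‖ < ε} ∧
      Tendsto (fun g : ℂ => (g ^ 2)⁻¹ • q (Dt (g • X)) (Dt (g • X))) (𝓝 0) (𝓝 0) :=
  ⟨analyticOnNhd_inv_sq_smul hε (analyticOnNhd_quad_Dt hC hCa hC₂ hb hHop hq hRC hDball hDfix q)
      (isBigO_quad_Dt hC hC₂ hb hHop hq hRC hDball hDfix hε q) X,
    tendsto_inv_sq_smul (isBigO_quad_Dt hC hC₂ hb hHop hq hRC hDball hDfix hε q) X⟩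

/-! ### The remainder term «(1/g_k²)V(H₁(g_kCB − hD̃(g_kCB)))» -/

omit [CompleteSpace 𝒴] [NormedSpace ℂ 𝒵] in
/-- `V ∘ H₁ ∘ Φ = O(‖Y‖³)` at `0` when `V = O(‖W‖³)` at `0` (`Φ = O(‖Y‖)`, `H₁` continuous linear). [folklore] -/
theorem isBigO_V_phi (hC : QuadAnalytic Ct C₂ R) (hC₂ : 0 ≤ C₂) (hb : 0 ≤ b)
    (hHop : ∀ X, ‖hop X‖ ≤ b * ‖X‖) (hq : 9 * C₂ * b * ε < 1) (hRC : 3 * ε ≤ R)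
    (hDball : ∀ B : 𝒴, ‖B‖ < ε → Dt B ∈ closedBall (0:𝒳) (4 * C₂ * ε ^ 2))
    (hDfix : ∀ B : 𝒴, ‖B‖ < ε → Ct (B - hop (Dt B)) = Dt B) (hε : 0 < ε)
    {V : 𝒲 → 𝒵} (hV : V =O[𝓝 (0:𝒲)] fun W => ‖W‖ ^ 3) (H₁ : 𝒴 →L[ℂ] 𝒲) :
    (fun Y => V (H₁ (Y - hop (Dt Y)))) =O[𝓝 (0:𝒴)] fun Y => ‖Y‖ ^ 3 := by
  have hΦ : (fun Y : 𝒴 => Y - hop (Dt Y)) =O[𝓝 (0:𝒴)] fun Y => Y := by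
    refine IsBigO.of_bound 2 ?_
    filter_upwards [isOpen_ball.mem_nhds (mem_ball_self hε)] with Y hY
    exact norm_phi_le_two_mul hC hC₂ hb hHop hq hRC hDball hDfix (mem_ball_zero_iff.mp hY)
  have hH : (fun Y : 𝒴 => H₁ (Y - hop (Dt Y))) =O[𝓝 (0:𝒴)] fun Y => Y :=
    (H₁.isBigO_comp _ _).trans hΦ
  have hT : Tendsto (fun Y : 𝒴 => H₁ (Y - hop (Dt Y))) (𝓝 0) (𝓝 0) :=
    hH.trans_tendsto tendsto_id
  have h1 : (fun Y => V (H₁ (Y - hop (Dt Y)))) =O[𝓝 (0:𝒴)] fun Y => ‖H₁ (Y - hop (Dt Y))‖ ^ 3 :=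
    hV.comp_tendsto hT
  exact h1.trans (hH.norm_norm.pow 3)

/-- `V ∘ H₁ ∘ Φ` is differentiable near `0` when `V` is analytic near `0` (`Φ` is analytic on the ball and
`H₁Φ(Y) → 0`). [folklore] -/
theorem eventually_differentiableAt_V_phi (hC : QuadAnalytic Ct C₂ R)
    (hCa : AnalyticOnNhd ℂ Ct {Y : 𝒴 | ‖Y‖ < R})
    (hC₂ : 0 ≤ C₂) (hb : 0 ≤ b) (hHop : ∀ X, ‖hop X‖ ≤ b * ‖X‖) (hq : 9 * C₂ * b * ε < 1)
    (hRC : 3 * ε ≤ R) (hDball : ∀ B : 𝒴, ‖B‖ < ε → Dt B ∈ closedBall (0:𝒳) (4 * C₂ * ε ^ 2))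
    (hDfix : ∀ B : 𝒴, ‖B‖ < ε → Ct (B - hop (Dt B)) = Dt B) (hε : 0 < ε)
    {V : 𝒲 → 𝒵} (hVa : ∀ᶠ W in 𝓝 (0:𝒲), AnalyticAt ℂ V W) (H₁ : 𝒴 →L[ℂ] 𝒲) :
    ∀ᶠ Y in 𝓝 (0:𝒴), DifferentiableAt ℂ (fun Y => V (H₁ (Y - hop (Dt Y)))) Y := by
  have hΦa := analyticOnNhd_phi hC hCa hC₂ hb hHop hq hRC hDball hDfix
  have hΦ0 : (0:𝒴) - hop (Dt 0) = 0 := by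
    rw [Dt_zero hC hC₂ hb hHop hq hRC hDball hDfix hε]; simp
  have hT0 : Tendsto (fun Y : 𝒴 => Y - hop (Dt Y)) (𝓝 0) (𝓝 0) := by
    have h := (hΦa 0 (mem_ball_self hε)).continuousAt.tendsto
    rwa [hΦ0] at h
  have hT : Tendsto (fun Y : 𝒴 => H₁ (Y - hop (Dt Y))) (𝓝 0) (𝓝 0) := by
    have h := (H₁.continuous.tendsto (0:𝒴)).comp hT0
    rwa [map_zero] at h
  filter_upwards [hT.eventually hVa, isOpen_ball.mem_nhds (mem_ball_self hε)] with Y hY hYb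
  exact (hY.comp_of_eq ((H₁.analyticAt _).comp_of_eq (hΦa Y hYb) rfl) rfl).differentiableAt

/-- **The remainder term `g ↦ (g²)⁻¹ • V(H₁Φ(gX))` is ANALYTIC AT `g = 0` (removable singularity) and tends to
`0`.** [folklore] -/
theorem analyticAt_scaled_V [CompleteSpace 𝒵] (hC : QuadAnalytic Ct C₂ R)
    (hCa : AnalyticOnNhd ℂ Ct {Y : 𝒴 | ‖Y‖ < R})
    (hC₂ : 0 ≤ C₂) (hb : 0 ≤ b) (hHop : ∀ X, ‖hop X‖ ≤ b * ‖X‖) (hq : 9 * C₂ * b * ε < 1)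
    (hRC : 3 * ε ≤ R) (hDball : ∀ B : 𝒴, ‖B‖ < ε → Dt B ∈ closedBall (0:𝒳) (4 * C₂ * ε ^ 2))
    (hDfix : ∀ B : 𝒴, ‖B‖ < ε → Ct (B - hop (Dt B)) = Dt B) (hε : 0 < ε)
    {V : 𝒲 → 𝒵} (hV : V =O[𝓝 (0:𝒲)] fun W => ‖W‖ ^ 3) (hVa : ∀ᶠ W in 𝓝 (0:𝒲), AnalyticAt ℂ V W)
    (H₁ : 𝒴 →L[ℂ] 𝒲) (X : 𝒴) :
    AnalyticAt ℂ (fun g : ℂ => (g ^ 2)⁻¹ • V (H₁ (g • X - hop (Dt (g • X))))) 0 ∧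
      Tendsto (fun g : ℂ => (g ^ 2)⁻¹ • V (H₁ (g • X - hop (Dt (g • X))))) (𝓝 0) (𝓝 0) :=
  ⟨analyticAt_inv_sq_smul (isBigO_V_phi hC hC₂ hb hHop hq hRC hDball hDfix hε hV H₁)
      (eventually_differentiableAt_V_phi hC hCa hC₂ hb hHop hq hRC hDball hDfix hε hVa H₁) X,
    tendsto_inv_sq_smul (isBigO_V_phi hC hC₂ hb hHop hq hRC hDball hDfix hε hV H₁) X⟩

/-! ### The curly bracket «{E_k(U_k(exp i[g_kCB − hD̃(g_kCB)]V⁽ᵏ⁾)) − E_k(U_k(V⁽ᵏ⁾))}» -/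

/-- **The curly bracket `g ↦ E(Φ(gX)) − E(0)` is analytic at `g = 0` with value `0` there** (`Φ(0) = 0`, i.e.
`D̃(0) = 0`, `B12SecondOrder267.Dt_zero`), for any `E` analytic at `0`. [folklore] -/
theorem analyticAt_scaled_bracket (hC : QuadAnalytic Ct C₂ R) (hCa : AnalyticOnNhd ℂ Ct {Y : 𝒴 | ‖Y‖ < R})
    (hC₂ : 0 ≤ C₂) (hb : 0 ≤ b) (hHop : ∀ X, ‖hop X‖ ≤ b * ‖X‖) (hq : 9 * C₂ * b * ε < 1)
    (hRC : 3 * ε ≤ R) (hDball : ∀ B : 𝒴, ‖B‖ < ε → Dt B ∈ closedBall (0:𝒳) (4 * C₂ * ε ^ 2))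
    (hDfix : ∀ B : 𝒴, ‖B‖ < ε → Ct (B - hop (Dt B)) = Dt B) (hε : 0 < ε)
    {E : 𝒴 → 𝒵} (hE : AnalyticAt ℂ E 0) (X : 𝒴) :
    AnalyticAt ℂ (fun g : ℂ => E (g • X - hop (Dt (g • X))) - E 0) 0 ∧
      (fun g : ℂ => E (g • X - hop (Dt (g • X))) - E 0) 0 = 0 := by
  have hΦa := analyticOnNhd_phi hC hCa hC₂ hb hHop hq hRC hDball hDfix
  have hD0 := Dt_zero hC hC₂ hb hHop hq hRC hDball hDfix hε
  have hΦ0 : (0:ℂ) • X - hop (Dt ((0:ℂ) • X)) = 0 := by rw [zero_smul, hD0]; simp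
  have hsc : AnalyticAt ℂ (fun g : ℂ => g • X) 0 := analyticAt_id.smul analyticAt_const
  have hmem : (0:ℂ) • X ∈ ball (0:𝒴) ε := by simp [hε]
  have h1 : AnalyticAt ℂ (fun g : ℂ => g • X - hop (Dt (g • X))) 0 := (hΦa _ hmem).comp_of_eq hsc rfl
  refine ⟨(hE.comp_of_eq h1 hΦ0).sub analyticAt_const, ?_⟩
  simp only [zero_smul, hD0, map_zero, sub_self]

/-! ### The Jacobian term «Tr log(I − h((δ/δB)D̃)(g_kCB))» as a function of the coupling -/

variable [FiniteDimensional ℂ 𝒴]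

/-- **The `Tr log` term `g ↦ Tr log DΦ(gX)` is analytic on the disc `|g|‖X‖ < ε`**
(`B12JacobianTrLog268.analyticOnNhd_trace_logJacobian` composed with the scaling). [folklore] -/
theorem analyticOnNhd_scaled_trace_logJacobian (hC : QuadAnalytic Ct C₂ R)
    (hCa : AnalyticOnNhd ℂ Ct {Y : 𝒴 | ‖Y‖ < R})
    (hC₂ : 0 ≤ C₂) (hb : 0 ≤ b) (hHop : ∀ X, ‖hop X‖ ≤ b * ‖X‖) (hq2 : 9 * C₂ * b * ε ≤ 1 / 2)
    (hRC : 3 * ε ≤ R) (hDball : ∀ B : 𝒴, ‖B‖ < ε → Dt B ∈ closedBall (0:𝒳) (4 * C₂ * ε ^ 2))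
    (hDfix : ∀ B : 𝒴, ‖B‖ < ε → Ct (B - hop (Dt B)) = Dt B) (X : 𝒴) :
    AnalyticOnNhd ℂ (fun g : ℂ => LinearMap.trace ℂ 𝒴
      ((mlog (1 - hop.mkContinuous b hHop ∘L fderiv ℂ Dt (g • X)) : 𝒴 →L[ℂ] 𝒴) : 𝒴 →ₗ[ℂ] 𝒴))
      {g : ℂ | ‖g‖ * ‖X‖ < ε} := by
  intro g hg
  have hmem : g • X ∈ ball (0:𝒴) ε := by rw [mem_ball_zero_iff, norm_smul]; exact hg
  exact (analyticOnNhd_trace_logJacobian hC hCa hC₂ hb hHop hq2 hRC hDball hDfix _ hmem).comp_of_eq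
    (analyticAt_id.smul analyticAt_const) rfl

omit [FiniteDimensional ℂ 𝒴] in
/-- **… with value `0` at `g = 0`** (`B12JacobianTrLog268.trace_logJacobian_zero`: `Tr log DΦ(0) = 0`, as
`DD̃(0) = 0`). [folklore] -/
theorem scaled_trace_logJacobian_zero (hC : QuadAnalytic Ct C₂ R) (hCa : AnalyticOnNhd ℂ Ct {Y : 𝒴 | ‖Y‖ < R})
    (hC₂ : 0 ≤ C₂) (hb : 0 ≤ b) (hHop : ∀ X, ‖hop X‖ ≤ b * ‖X‖) (hq : 9 * C₂ * b * ε < 1)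
    (hRC : 3 * ε ≤ R) (hDball : ∀ B : 𝒴, ‖B‖ < ε → Dt B ∈ closedBall (0:𝒳) (4 * C₂ * ε ^ 2))
    (hDfix : ∀ B : 𝒴, ‖B‖ < ε → Ct (B - hop (Dt B)) = Dt B) (hε : 0 < ε) (X : 𝒴) :
    LinearMap.trace ℂ 𝒴
      ((mlog (1 - hop.mkContinuous b hHop ∘L fderiv ℂ Dt ((0:ℂ) • X)) : 𝒴 →L[ℂ] 𝒴) : 𝒴 →ₗ[ℂ] 𝒴) = 0 := by
  rw [zero_smul]; exact trace_logJacobian_zero hC hCa hC₂ hb hHop hq hRC hDball hDfix hε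

/-- **… and tending to `0` with the coupling.** [folklore] -/
theorem tendsto_scaled_trace_logJacobian (hC : QuadAnalytic Ct C₂ R)
    (hCa : AnalyticOnNhd ℂ Ct {Y : 𝒴 | ‖Y‖ < R})
    (hC₂ : 0 ≤ C₂) (hb : 0 ≤ b) (hHop : ∀ X, ‖hop X‖ ≤ b * ‖X‖) (hq2 : 9 * C₂ * b * ε ≤ 1 / 2)
    (hRC : 3 * ε ≤ R) (hDball : ∀ B : 𝒴, ‖B‖ < ε → Dt B ∈ closedBall (0:𝒳) (4 * C₂ * ε ^ 2))
    (hDfix : ∀ B : 𝒴, ‖B‖ < ε → Ct (B - hop (Dt B)) = Dt B) (hε : 0 < ε) (X : 𝒴) :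
    Tendsto (fun g : ℂ => LinearMap.trace ℂ 𝒴
      ((mlog (1 - hop.mkContinuous b hHop ∘L fderiv ℂ Dt (g • X)) : 𝒴 →L[ℂ] 𝒴) : 𝒴 →ₗ[ℂ] 𝒴))
      (𝓝 0) (𝓝 0) := by
  have h0 : (0:ℂ) ∈ {g : ℂ | ‖g‖ * ‖X‖ < ε} := by simp [hε]
  have h := (analyticOnNhd_scaled_trace_logJacobian hC hCa hC₂ hb hHop hq2 hRC hDball hDfix X 0
    h0).continuousAt.tendsto
  rwa [scaled_trace_logJacobian_zero hC hCa hC₂ hb hHop (lt_one_of_le_half hq2) hRC hDball hDfix hε X] at h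

end shares

/-! ## §3  Transcription for B12 (2.12)–(2.14) p. 268 -/
section transcription

variable {𝒳 𝒴 𝒲 : Type*} [NormedAddCommGroup 𝒳] [NormedSpace ℂ 𝒳] [CompleteSpace 𝒳]
  [NormedAddCommGroup 𝒴] [NormedSpace ℂ 𝒴] [CompleteSpace 𝒴] [FiniteDimensional ℂ 𝒴]
  [NormedAddCommGroup 𝒲] [NormedSpace ℂ 𝒲]

/-- **B12 p. 268 «Let us remark that the expression under the exponential above vanishes at g_k = 0»** for the
schematic exponent of (2.12) ∕ integrand of (2.13): with the hypothesis-style `D̃` of `B12Lineariz267` …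
`B12JacobianTrLog268` (`9C₂bε ≤ 1/2`, `3ε ≤ R`, `0 < ε`, finite-dimensional `𝒴`), a direction `X` (print's `CB`)
and `X'` (print's `B` in the `G₃` term), continuous (bi)linear `ℓ`, `β`, `q` (the pairings with `H₁`, `h`, `J`,
`Δ₁`), `G₃ = O(‖B‖³)` differentiable near `0`, `V = O(‖W‖³)` analytic near `0` composed with a continuous linear
`H₁`, and `E` analytic at `0` (the curly bracket), EVERY function `P : ℂ → ℂ` of the coupling given by the signed
sum of the seven typed terms
`P(g) = Tr log DΦ(gX) + (g²)⁻¹ℓ(D̃₃(gX)) − (g²)⁻¹G₃(gX') + (g²)⁻¹β(gX)(D̃(gX)) − (g²)⁻¹q(D̃(gX))(D̃(gX))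
 − (g²)⁻¹V(H₁Φ(gX)) + (E(Φ(gX)) − E(0))`
is ANALYTIC at `g = 0`, has `P(0) = 0`, and `P(g) → 0` as `g → 0`.  Term by term: §2.  Everything about `D̃`, `C̃`,
`h` and the schematic functionals is a HYPOTHESIS; the `log σ` term, the integral, (2.13)–(2.14) themselves and all
uniformity in the field ∕ background ∕ scale are NOT typed; nothing printed is asserted.
[cite: Balaban1987RG1, (2.12)-(2.14) p.268] -/
theorem p268_vanishes_at_zero_coupling {hop : 𝒳 →ₗ[ℂ] 𝒴} {Ct : 𝒴 → 𝒳} {C₂ R b ε : ℝ} {Dt : 𝒴 → 𝒳}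
    (hC : B13Contraction113.QuadAnalytic Ct C₂ R) (hCa : AnalyticOnNhd ℂ Ct {Y : 𝒴 | ‖Y‖ < R})
    (hC₂ : 0 ≤ C₂) (hb : 0 ≤ b) (hHop : ∀ X, ‖hop X‖ ≤ b * ‖X‖) (hq2 : 9 * C₂ * b * ε ≤ 1 / 2)
    (hRC : 3 * ε ≤ R) (hDball : ∀ B : 𝒴, ‖B‖ < ε → Dt B ∈ closedBall (0:𝒳) (4 * C₂ * ε ^ 2))
    (hDfix : ∀ B : 𝒴, ‖B‖ < ε → Ct (B - hop (Dt B)) = Dt B) (hε : 0 < ε)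
    (ℓ : 𝒳 →L[ℂ] ℂ) {G₃ : 𝒴 → ℂ} (hG : G₃ =O[𝓝 (0:𝒴)] fun Y => ‖Y‖ ^ 3)
    (hGd : ∀ᶠ Y in 𝓝 (0:𝒴), DifferentiableAt ℂ G₃ Y)
    (β : 𝒴 →L[ℂ] 𝒳 →L[ℂ] ℂ) (q : 𝒳 →L[ℂ] 𝒳 →L[ℂ] ℂ)
    {V : 𝒲 → ℂ} (hV : V =O[𝓝 (0:𝒲)] fun W => ‖W‖ ^ 3) (hVa : ∀ᶠ W in 𝓝 (0:𝒲), AnalyticAt ℂ V W)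
    (H₁ : 𝒴 →L[ℂ] 𝒲) {E : 𝒴 → ℂ} (hE : AnalyticAt ℂ E 0) (X X' : 𝒴)
    (P : ℂ → ℂ) (hP : ∀ g : ℂ, P g =
      LinearMap.trace ℂ 𝒴
          ((mlog (1 - hop.mkContinuous b hHop ∘L fderiv ℂ Dt (g • X)) : 𝒴 →L[ℂ] 𝒴) : 𝒴 →ₗ[ℂ] 𝒴)
        + (g ^ 2)⁻¹ • ℓ (Dt (g • X) - (2:ℂ)⁻¹ • iteratedFDeriv ℂ 2 Ct 0 (fun _ => g • X))
        - (g ^ 2)⁻¹ • G₃ (g • X')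
        + (g ^ 2)⁻¹ • β (g • X) (Dt (g • X))
        - (g ^ 2)⁻¹ • q (Dt (g • X)) (Dt (g • X))
        - (g ^ 2)⁻¹ • V (H₁ (g • X - hop (Dt (g • X))))
        + (E (g • X - hop (Dt (g • X))) - E 0)) :
    AnalyticAt ℂ P 0 ∧ P 0 = 0 ∧ Tendsto P (𝓝 0) (𝓝 0) := by
  have hq : 9 * C₂ * b * ε < 1 := lt_one_of_le_half hq2
  have h0 : (0:ℂ) ∈ {g : ℂ | ‖g‖ * ‖X‖ < ε} := by simp [hε]
  have hPfun : P = fun g : ℂ =>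
      LinearMap.trace ℂ 𝒴
          ((mlog (1 - hop.mkContinuous b hHop ∘L fderiv ℂ Dt (g • X)) : 𝒴 →L[ℂ] 𝒴) : 𝒴 →ₗ[ℂ] 𝒴)
        + (g ^ 2)⁻¹ • ℓ (Dt (g • X) - (2:ℂ)⁻¹ • iteratedFDeriv ℂ 2 Ct 0 (fun _ => g • X))
        - (g ^ 2)⁻¹ • G₃ (g • X')
        + (g ^ 2)⁻¹ • β (g • X) (Dt (g • X))
        - (g ^ 2)⁻¹ • q (Dt (g • X)) (Dt (g • X))
        - (g ^ 2)⁻¹ • V (H₁ (g • X - hop (Dt (g • X))))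
        + (E (g • X - hop (Dt (g • X))) - E 0) := funext hP
  -- term-by-term analyticity at `g = 0`
  have hA1 := analyticOnNhd_scaled_trace_logJacobian hC hCa hC₂ hb hHop hq2 hRC hDball hDfix X 0 h0
  have hA2 := analyticOnNhd_scaled_Dt3 hC hCa hC₂ hb hHop hq hRC hDball hDfix hε ℓ X 0 h0
  have hA3 : AnalyticAt ℂ (fun g : ℂ => (g ^ 2)⁻¹ • G₃ (g • X')) 0 := analyticAt_inv_sq_smul hG hGd X'
  have hA4 := (analyticOnNhd_scaled_bilin hC hCa hC₂ hb hHop hq hRC hDball hDfix hε β X).1 0 h0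
  have hA5 := (analyticOnNhd_scaled_quad hC hCa hC₂ hb hHop hq hRC hDball hDfix hε q X).1 0 h0
  have hA6 := (analyticAt_scaled_V hC hCa hC₂ hb hHop hq hRC hDball hDfix hε hV hVa H₁ X).1
  have hA7 := (analyticAt_scaled_bracket hC hCa hC₂ hb hHop hq hRC hDball hDfix hε hE X).1
  have hA : AnalyticAt ℂ P 0 := by
    rw [hPfun]
    exact (((((hA1.add hA2).sub hA3).add hA4).sub hA5).sub hA6).add hA7
  -- the value at `g = 0`
  have hD0 := Dt_zero hC hC₂ hb hHop hq hRC hDball hDfix hε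
  have hT0 := trace_logJacobian_zero hC hCa hC₂ hb hHop hq hRC hDball hDfix hε
  have hP0 : P 0 = 0 := by
    rw [hP]
    simp [hD0, hT0]
  refine ⟨hA, hP0, ?_⟩
  have h := hA.continuousAt.tendsto
  rwa [hP0] at h

/-- Non-vacuity: the hypotheses of `p268_vanishes_at_zero_coupling` are jointly satisfiable — the degenerate model
`𝒳 = 𝒴 = 𝒲 = ℂ`, `h = id`, `C̃ = D̃ = 0`, `C₂ = 0`, `R = 3`, `b = ε = 1`, all functionals `0`, `E = 0`: the
exponent is identically `0`. -/
example : AnalyticAt ℂ (fun _ : ℂ => (0:ℂ)) 0 ∧ (fun _ : ℂ => (0:ℂ)) 0 = 0 ∧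
    Tendsto (fun _ : ℂ => (0:ℂ)) (𝓝 0) (𝓝 0) :=
  p268_vanishes_at_zero_coupling (𝒳 := ℂ) (𝒴 := ℂ) (𝒲 := ℂ) (hop := LinearMap.id) (Ct := fun _ => 0)
    (C₂ := 0) (R := 3) (b := 1) (ε := 1) (Dt := fun _ => 0)
    ⟨fun Y _ => by simp, fun P Q => differentiableOn_const (0:ℂ)⟩ (fun Y _ => analyticAt_const) le_rfl
    zero_le_one (fun X => by simp) (by norm_num) (by norm_num) (fun B _ => by simp) (fun B _ => by simp) one_pos
    0 (G₃ := fun _ => 0) (isBigO_zero _ _) (Eventually.of_forall fun _ => differentiableAt_const _) 0 0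
    (V := fun _ => 0) (isBigO_zero _ _) (Eventually.of_forall fun _ => analyticAt_const) 0
    (E := fun _ => 0) analyticAt_const 0 0 (fun _ => 0) (fun g => by simp)

end transcription

end Literature.MathematicalPhysics.QuantumFieldTheory.Balaban1983to89.B12ZeroCoupling268
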